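import Mathlib
import Summits.Ventures.PercRepro2.Defs
import Summits.Ventures.PercRepro2.Independence
import Summits.Ventures.PercRepro2.Harris
import Summits.Ventures.PercRepro2.Graph
import Summits.Ventures.PercRepro2.Events
import Summits.Ventures.PercRepro2.ZCK4
import Summits.Ventures.PercRepro2.ZCK4Embed

/-!
# (ZC) on `K₄` for every placement of the marks (blind cell PercRepro2, mine-a g27)

`zc_k4` proves (ZC) on `K₄` for the marks `(0, 1, 2)`; `zc_k4_embed` transports it along any embedding —
in particular along the 24 relabellings of `K₄` itself.  Hence (ZC) holds on `K₄` for EVERY choice of three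
distinct marks, every weight vector and every cluster up-set (`zc_k4_all_marks`): the 24 cells of `K₄` in the
coverage census of MINE-A.md §73.2 — the only cells outside the dismantlable class at `n = 4` — are all in the
kernel, so `n = 4` is complete (144 / 144 cells).
-/

namespace Summit.Ventures.PercRepro2

/-- **(ZC) on `K₄` for every placement of the marks**: for all distinct `a₁ a₃ o : Fin 4`, every weight
vector in `[0, 1]^6` and every cluster up-set. -/
theorem zc_k4_all_marks {R : Type*} [CommRing R] [LinearOrder R] [IsStrictOrderedRing R]
    {p : Fin 6 → R} (hp : IsProbVec p) {𝓔 : Set (Set (Fin 4))} (h𝓔 : IsUpperSet 𝓔)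
    (a₁ a₃ o : Fin 4) (h₁₃ : a₁ ≠ a₃) (h₁ₒ : a₁ ≠ o) (h₃ₒ : a₃ ≠ o) :
    let ends : Fin 6 → Sym2 (Fin 4) := ![s(0, 1), s(0, 2), s(0, 3), s(1, 2), s(1, 3), s(2, 3)]
    let e := connEvent ends a₁ a₃
    let L' := connEvent ends a₁ o
    let U := clusterInEvent ends a₁ 𝓔
    let γ := connEvent ends a₃ o
    0 ≤ prob p (eᶜ ∩ L'ᶜ ∩ γᶜ) * (prob p (U ∩ (e ∩ L')) - prob p U * prob p (e ∩ L'))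
      - prob p (eᶜ ∩ L'ᶜ ∩ γ) * (prob p (U ∩ (e ∩ L'ᶜ)) - prob p U * prob p (e ∩ L'ᶜ)) := by
  intro ends e L' U γ
  fin_cases a₁ <;> fin_cases a₃ <;> fin_cases o <;>
    simp only [ne_eq, not_true_eq_false] at h₁₃ h₁ₒ h₃ₒ
  · simpa [e, L', U, γ] using zc_k4_embed (ends := ends) hp (ι := ![0, 1, 2, 3]) (by decide) (φ := ![0, 1, 2, 3, 4, 5]) (by decide) (by decide)
      (by intro e he; fin_cases e <;> exact absurd he (by decide)) h𝓔
  · simpa [e, L', U, γ] using zc_k4_embed (ends := ends) hp (ι := ![0, 1, 3, 2]) (by decide) (φ := ![0, 2, 1, 4, 3, 5]) (by decide) (by decide)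
      (by intro e he; fin_cases e <;> exact absurd he (by decide)) h𝓔
  · simpa [e, L', U, γ] using zc_k4_embed (ends := ends) hp (ι := ![0, 2, 1, 3]) (by decide) (φ := ![1, 0, 2, 3, 5, 4]) (by decide) (by decide)
      (by intro e he; fin_cases e <;> exact absurd he (by decide)) h𝓔
  · simpa [e, L', U, γ] using zc_k4_embed (ends := ends) hp (ι := ![0, 2, 3, 1]) (by decide) (φ := ![1, 2, 0, 5, 3, 4]) (by decide) (by decide)
      (by intro e he; fin_cases e <;> exact absurd he (by decide)) h𝓔
  · simpa [e, L', U, γ] using zc_k4_embed (ends := ends) hp (ι := ![0, 3, 1, 2]) (by decide) (φ := ![2, 0, 1, 4, 5, 3]) (by decide) (by decide)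
      (by intro e he; fin_cases e <;> exact absurd he (by decide)) h𝓔
  · simpa [e, L', U, γ] using zc_k4_embed (ends := ends) hp (ι := ![0, 3, 2, 1]) (by decide) (φ := ![2, 1, 0, 5, 4, 3]) (by decide) (by decide)
      (by intro e he; fin_cases e <;> exact absurd he (by decide)) h𝓔
  · simpa [e, L', U, γ] using zc_k4_embed (ends := ends) hp (ι := ![1, 0, 2, 3]) (by decide) (φ := ![0, 3, 4, 1, 2, 5]) (by decide) (by decide)
      (by intro e he; fin_cases e <;> exact absurd he (by decide)) h𝓔
  · simpa [e, L', U, γ] using zc_k4_embed (ends := ends) hp (ι := ![1, 0, 3, 2]) (by decide) (φ := ![0, 4, 3, 2, 1, 5]) (by decide) (by decide)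
      (by intro e he; fin_cases e <;> exact absurd he (by decide)) h𝓔
  · simpa [e, L', U, γ] using zc_k4_embed (ends := ends) hp (ι := ![1, 2, 0, 3]) (by decide) (φ := ![3, 0, 4, 1, 5, 2]) (by decide) (by decide)
      (by intro e he; fin_cases e <;> exact absurd he (by decide)) h𝓔
  · simpa [e, L', U, γ] using zc_k4_embed (ends := ends) hp (ι := ![1, 2, 3, 0]) (by decide) (φ := ![3, 4, 0, 5, 1, 2]) (by decide) (by decide)
      (by intro e he; fin_cases e <;> exact absurd he (by decide)) h𝓔
  · simpa [e, L', U, γ] using zc_k4_embed (ends := ends) hp (ι := ![1, 3, 0, 2]) (by decide) (φ := ![4, 0, 3, 2, 5, 1]) (by decide) (by decide)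
      (by intro e he; fin_cases e <;> exact absurd he (by decide)) h𝓔
  · simpa [e, L', U, γ] using zc_k4_embed (ends := ends) hp (ι := ![1, 3, 2, 0]) (by decide) (φ := ![4, 3, 0, 5, 2, 1]) (by decide) (by decide)
      (by intro e he; fin_cases e <;> exact absurd he (by decide)) h𝓔
  · simpa [e, L', U, γ] using zc_k4_embed (ends := ends) hp (ι := ![2, 0, 1, 3]) (by decide) (φ := ![1, 3, 5, 0, 2, 4]) (by decide) (by decide)
      (by intro e he; fin_cases e <;> exact absurd he (by decide)) h𝓔
  · simpa [e, L', U, γ] using zc_k4_embed (ends := ends) hp (ι := ![2, 0, 3, 1]) (by decide) (φ := ![1, 5, 3, 2, 0, 4]) (by decide) (by decide)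
      (by intro e he; fin_cases e <;> exact absurd he (by decide)) h𝓔
  · simpa [e, L', U, γ] using zc_k4_embed (ends := ends) hp (ι := ![2, 1, 0, 3]) (by decide) (φ := ![3, 1, 5, 0, 4, 2]) (by decide) (by decide)
      (by intro e he; fin_cases e <;> exact absurd he (by decide)) h𝓔
  · simpa [e, L', U, γ] using zc_k4_embed (ends := ends) hp (ι := ![2, 1, 3, 0]) (by decide) (φ := ![3, 5, 1, 4, 0, 2]) (by decide) (by decide)
      (by intro e he; fin_cases e <;> exact absurd he (by decide)) h𝓔
  · simpa [e, L', U, γ] using zc_k4_embed (ends := ends) hp (ι := ![2, 3, 0, 1]) (by decide) (φ := ![5, 1, 3, 2, 4, 0]) (by decide) (by decide)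
      (by intro e he; fin_cases e <;> exact absurd he (by decide)) h𝓔
  · simpa [e, L', U, γ] using zc_k4_embed (ends := ends) hp (ι := ![2, 3, 1, 0]) (by decide) (φ := ![5, 3, 1, 4, 2, 0]) (by decide) (by decide)
      (by intro e he; fin_cases e <;> exact absurd he (by decide)) h𝓔
  · simpa [e, L', U, γ] using zc_k4_embed (ends := ends) hp (ι := ![3, 0, 1, 2]) (by decide) (φ := ![2, 4, 5, 0, 1, 3]) (by decide) (by decide)
      (by intro e he; fin_cases e <;> exact absurd he (by decide)) h𝓔
  · simpa [e, L', U, γ] using zc_k4_embed (ends := ends) hp (ι := ![3, 0, 2, 1]) (by decide) (φ := ![2, 5, 4, 1, 0, 3]) (by decide) (by decide)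
      (by intro e he; fin_cases e <;> exact absurd he (by decide)) h𝓔
  · simpa [e, L', U, γ] using zc_k4_embed (ends := ends) hp (ι := ![3, 1, 0, 2]) (by decide) (φ := ![4, 2, 5, 0, 3, 1]) (by decide) (by decide)
      (by intro e he; fin_cases e <;> exact absurd he (by decide)) h𝓔
  · simpa [e, L', U, γ] using zc_k4_embed (ends := ends) hp (ι := ![3, 1, 2, 0]) (by decide) (φ := ![4, 5, 2, 3, 0, 1]) (by decide) (by decide)
      (by intro e he; fin_cases e <;> exact absurd he (by decide)) h𝓔
  · simpa [e, L', U, γ] using zc_k4_embed (ends := ends) hp (ι := ![3, 2, 0, 1]) (by decide) (φ := ![5, 2, 4, 1, 3, 0]) (by decide) (by decide)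
      (by intro e he; fin_cases e <;> exact absurd he (by decide)) h𝓔
  · simpa [e, L', U, γ] using zc_k4_embed (ends := ends) hp (ι := ![3, 2, 1, 0]) (by decide) (φ := ![5, 4, 2, 3, 1, 0]) (by decide) (by decide)
      (by intro e he; fin_cases e <;> exact absurd he (by decide)) h𝓔

end Summit.Ventures.PercRepro2
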